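import Literature.Geometry.Lorentzian.KillingHorizonShadowAlong
import Literature.Geometry.Lorentzian.StaticBlackHoleUniquenessProofs
import Literature.Geometry.Lorentzian.LorentzianMetricProofs
import Literature.Geometry.Lorentzian.CausalityOpennessProofs
import Literature.Geometry.Lorentzian.KillingAlgebraAsymptoticallyFlat
import Literature.Geometry.Lorentzian.LeviCivitaProofs
import Literature.Geometry.Lorentzian.CurvatureProofs

/-!
# Stub `stub_horizonKilling_of_nonrotating` (P1) of crux `HawkingExtensionIsKerr`, line `SketchIdeator2`

In the non-rotating branch of the lead skeleton (`K' = c • T` on the d.o.c., `T = 𝓑.killing`),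
the surface-gravity clause `∇_K K = κ K` on `𝓔⁺` of the collar Killing field `K` (Killing on an
open `U ⊇ 𝓔⁺`, equal to `K'` on `U' ∩ ⟨⟨M_ext⟩⟩`, `U' ⊇ 𝓔⁺` open) is transported to `T`:
`c ≠ 0`, `T ≠ 0` on `𝓔⁺` and `∇_T T = (c⁻¹ κ) T` on `𝓔⁺`.

Proof.  The difference `D := K - c • T` is `C^∞` on `U` and vanishes on the open set
`U' ∩ ⟨⟨M_ext⟩⟩`; every `p ∈ 𝓔⁺` lies in `closure ⟨⟨M_ext⟩⟩`
(`StationaryAFBlackHole.horizon_subset_closure_doc`), hence in the closure of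
`W := U ∩ U' ∩ ⟨⟨M_ext⟩⟩`.  (i) `D p = 0` by continuity of `D` at `p` (a continuous section of a
vector bundle vanishing on a set vanishes on its closure, read in the trivialization at `p`), so
`K p = c • T p`, whence `c ≠ 0` and `T p ≠ 0` from `K p ≠ 0` (this is where `𝓔⁺ ≠ ∅` is needed
for `c ≠ 0`).  (ii) The field `S := ∇_T D : y ↦ ∇D(y)(T y)` is differentiable at `p` (the
Levi-Civita connection of the smooth metric is locally `C¹`, `isLocallyContMDiff_leviCivita_holds`,
and `CovariantDerivative.mdifferentiableAt_cov_apply`), and vanishes on `W` (locality of `∇` on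
differentiable sections, Mathlib's `IsCovariantDerivativeOn.congr_of_eventuallyEq` with the zero
section); hence `∇D(p)(T p) = 0` by the same closure lemma.  (iii) At `p`:
`∇K(p) = ∇D(p) + c ∇T(p)` (additivity and homogeneity of `∇` on sections differentiable at `p`), so
`κ c T p = κ K p = ∇_{K p} K = c ∇D(p)(T p) + c² ∇_{T p} T = c² ∇_{T p} T`, and `∇_{T p} T = (c⁻¹κ) T p`.
-/

noncomputable section

set_option linter.dupNamespace false

namespace Summit.FinalStateConjecture.FinalStateConjecture.Theorems.HawkingExtensionIsKerr.SketchIdeator2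

open Set Function Bundle Literature.Geometry.Lorentzian
open scoped Manifold ContDiff Topology

/-- **A section of a vector bundle which is continuous at `p` within `s` and vanishes on `s`
vanishes at every `p ∈ closure s`.**  Read the section in the (fibrewise linear) trivialization at
`p`: the fibre coordinate is continuous within `s` at `p` (`FiberBundle.continuousWithinAt_section`),
vanishes on `s ∩ baseSet`, hence at `p`; and the trivialization is a linear equivalence on the fibre
at `p`. [folklore] -/
private theorem stub_horizonKilling_eq_zero_of_mem_closure
    {B : Type*} [TopologicalSpace B] {F : Type*} [NormedAddCommGroup F] [NormedSpace ℝ F]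
    {V : B → Type*} [TopologicalSpace (TotalSpace F V)] [∀ x, AddCommMonoid (V x)]
    [∀ x, Module ℝ (V x)] [∀ x, TopologicalSpace (V x)] [FiberBundle F V] [VectorBundle ℝ F V]
    {σ : Π x, V x} {s : Set B} {p : B}
    (hσ : ContinuousWithinAt (fun x ↦ TotalSpace.mk' F x (σ x)) s p) (hp : p ∈ closure s)
    (hs : ∀ x ∈ s, σ x = 0) : σ p = 0 := by
  have hpb : p ∈ (trivializationAt F V p).baseSet := mem_baseSet_trivializationAt F V p
  have hf := (FiberBundle.continuousWithinAt_section F).mp hσ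
  have hp' : p ∈ closure (s ∩ (trivializationAt F V p).baseSet) :=
    (trivializationAt F V p).open_baseSet.closure_inter ⟨hp, hpb⟩
  have hmaps : MapsTo (fun x ↦ (trivializationAt F V p ⟨x, σ x⟩).2)
      (s ∩ (trivializationAt F V p).baseSet) {0} := by
    rintro x ⟨hxs, hxb⟩
    have h0 := (trivializationAt F V p).zeroSection ℝ hxb
    simp only [zeroSection] at h0
    simp only [mem_singleton_iff, hs x hxs, h0]
  have h0 : (trivializationAt F V p ⟨p, σ p⟩).2 ∈ closure ({0} : Set F) :=
    (hf.mono inter_subset_left).mem_closure hp' hmaps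
  rw [closure_singleton, mem_singleton_iff] at h0
  have h1 : (trivializationAt F V p).continuousLinearEquivAt ℝ p hpb (σ p) = 0 := by
    simpa only [Trivialization.continuousLinearEquivAt_apply] using h0
  exact (map_eq_zero_iff _ ((trivializationAt F V p).continuousLinearEquivAt ℝ p hpb).injective).1 h1

/-- `2 ≤ ∞` in `ℕ∞ω`. [folklore] -/
private theorem stub_horizonKilling_two_le_infty : (2 : ℕ∞ω) ≤ ∞ :=
  WithTop.coe_le_coe.mpr le_top

/-- `1 ≤ ∞` in `ℕ∞ω`. [folklore] -/
private theorem stub_horizonKilling_one_le_infty : (1 : ℕ∞ω) ≤ ∞ :=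
  WithTop.coe_le_coe.mpr le_top

/-- **Stub P1 (worker): in the non-rotating case the `κ`-clause passes from the collar field to
`T`.**  If `K' = c • T` on the d.o.c. and `K = K'` on `U' ∩ doc` near `𝓔⁺`, then `K − c T` is
`C^∞` near `𝓔⁺` and vanishes on the open trace `U ∩ U' ∩ ⟨⟨M_ext⟩⟩`, in whose closure `𝓔⁺` lies
(`𝓔⁺ ⊆ closure ⟨⟨M_ext⟩⟩`); by continuity `K = c T` and `∇_T (K - c T) = 0` on `𝓔⁺`, so (for
`𝓔⁺ ≠ ∅`) `c ≠ 0`, `T ≠ 0` on `𝓔⁺` and `∇_T T = (c⁻¹ κ) T` there. -/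
theorem stub_horizonKilling_of_nonrotating :
    ∀ (𝓑 : StationaryAFBlackHole.{0}) [𝓑.metric.HasLeviCivita]
      (U U' : Set 𝓑.carrier) (K K' : Π x : 𝓑.carrier, TangentSpace (𝓡 4) x) (c κ : ℝ),
      IsOpen U → 𝓑.horizon ⊆ U → 𝓑.metric.toPseudoRiemannianMetric.IsKillingFieldOn K U →
      IsOpen U' → 𝓑.horizon ⊆ U' → (∀ x ∈ U' ∩ 𝓑.doc, K' x = K x) →
      (∀ x ∈ 𝓑.doc, K' x = c • 𝓑.killing x) →
      (∀ p ∈ 𝓑.horizon, K p ≠ 0) →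
      (∀ p ∈ 𝓑.horizon, 𝓑.metric.leviCivita K p (K p) = κ • K p) →
      𝓑.horizon.Nonempty →
      c ≠ 0 ∧ (∀ p ∈ 𝓑.horizon, 𝓑.killing p ≠ 0) ∧
        ∀ p ∈ 𝓑.horizon, 𝓑.metric.leviCivita 𝓑.killing p (𝓑.killing p) = (c⁻¹ * κ) • 𝓑.killing p := by
  intro 𝓑 _ U U' K K' c κ hU hHU hKon hU' hHU' hK'K hc hKne hκK hne
  -- openness of `I^±`, openness of the d.o.c., `𝓔⁺ ⊆ closure doc`
  have hdoc : IsOpen 𝓑.doc :=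
    𝓑.isOpen_doc LorentzianMetric.isOpen_chronologicalFuture_holds_of_boundaryless
      LorentzianMetric.isOpen_chronologicalPast_holds_of_boundaryless
  have hclos : ∀ p ∈ 𝓑.horizon, p ∈ closure (U ∩ U' ∩ 𝓑.doc) := fun p hp ↦
    (hU.inter hU').inter_closure ⟨⟨hHU hp, hHU' hp⟩,
      𝓑.horizon_subset_closure_doc LorentzianMetric.isOpen_chronologicalFuture_holds_of_boundaryless
        LorentzianMetric.isOpen_chronologicalPast_holds_of_boundaryless hp⟩
  -- the stationary Killing field is smooth
  have hT : 𝓑.metric.IsKillingField 𝓑.killing := 𝓑.isStationaryKilling.isKillingField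
  have hTc : ContMDiff (𝓡 4) (𝓡 4).tangent ∞
      (fun x ↦ (TotalSpace.mk' E4 x (𝓑.killing x) : TangentBundle (𝓡 4) 𝓑.carrier)) :=
    hT.contMDiff
  -- the difference field `D := K - c • T`
  obtain ⟨D, hD⟩ : ∃ D : Π x : 𝓑.carrier, TangentSpace (𝓡 4) x, D = K - c • 𝓑.killing := ⟨_, rfl⟩
  have hDapply : ∀ x, D x = K x - c • 𝓑.killing x := fun x ↦ by rw [hD]; rfl
  have hD0 : ∀ x ∈ U' ∩ 𝓑.doc, D x = 0 := fun x hx ↦ by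
    rw [hDapply, ← hK'K x hx, hc x hx.2, sub_self]
  have hDc : ∀ p ∈ U, ContMDiffAt (𝓡 4) (𝓡 4).tangent ∞
      (fun x ↦ (TotalSpace.mk' E4 x (D x) : TangentBundle (𝓡 4) 𝓑.carrier)) p := fun p hp ↦ by
    rw [hD]
    exact (hKon.contMDiffAt hU hp).sub_section (hTc p).const_smul_section
  -- (i) `D = 0` on the horizon
  have hDp : ∀ p ∈ 𝓑.horizon, D p = 0 := fun p hp ↦
    stub_horizonKilling_eq_zero_of_mem_closure (hDc p (hHU hp)).continuousAt.continuousWithinAt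
      (hclos p hp) (fun x hx ↦ hD0 x ⟨hx.1.2, hx.2⟩)
  have hKp : ∀ p ∈ 𝓑.horizon, K p = c • 𝓑.killing p := fun p hp ↦ by
    rw [← sub_eq_zero, ← hDapply]
    exact hDp p hp
  obtain ⟨p₀, hp₀⟩ := hne
  have hc0 : c ≠ 0 := by
    rintro rfl
    exact hKne p₀ hp₀ (by rw [hKp p₀ hp₀, zero_smul])
  have hTne : ∀ p ∈ 𝓑.horizon, 𝓑.killing p ≠ 0 := fun p hp h0 ↦
    hKne p hp (by rw [hKp p hp, h0, smul_zero])
  refine ⟨hc0, hTne, fun p hp ↦ ?_⟩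
  have hpU : p ∈ U := hHU hp
  -- (ii) `∇_T D = 0` at `p`
  have hreg : 𝓑.metric.leviCivita.IsLocallyContMDiff 1 :=
    𝓑.metric.isLocallyContMDiff_leviCivita_holds 1 (by exact_mod_cast le_top)
  have hDU : ContMDiffOn (𝓡 4) (𝓡 4).tangent 2
      (fun x ↦ (TotalSpace.mk' E4 x (D x) : TangentBundle (𝓡 4) 𝓑.carrier)) U := by
    rw [hD]
    exact (hKon.contMDiffOn.sub_section hTc.contMDiffOn.const_smul_section).of_le
      stub_horizonKilling_two_le_infty
  have hTU : ContMDiffOn (𝓡 4) (𝓡 4).tangent 1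
      (fun x ↦ (TotalSpace.mk' E4 x (𝓑.killing x) : TangentBundle (𝓡 4) 𝓑.carrier)) U :=
    hTc.contMDiffOn.of_le stub_horizonKilling_one_le_infty
  have hS : MDifferentiableAt (𝓡 4) (𝓡 4).tangent
      (fun y ↦ (TotalSpace.mk' E4 y (𝓑.metric.leviCivita D y (𝓑.killing y)) :
        TangentBundle (𝓡 4) 𝓑.carrier)) p :=
    𝓑.metric.leviCivita.mdifferentiableAt_cov_apply hreg hU hpU hTU hDU
  have hS0 : ∀ x ∈ U ∩ U' ∩ 𝓑.doc, 𝓑.metric.leviCivita D x (𝓑.killing x) = 0 := by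
    rintro x ⟨⟨hxU, hxU'⟩, hxd⟩
    have hDx : MDifferentiableAt (𝓡 4) (𝓡 4).tangent
        (fun y ↦ (TotalSpace.mk' E4 y (D y) : TangentBundle (𝓡 4) 𝓑.carrier)) x :=
      (hDc x hxU).mdifferentiableAt (by simp)
    have h0x : MDifferentiableAt (𝓡 4) (𝓡 4).tangent
        (fun y ↦ (TotalSpace.mk' E4 y ((0 : Π y : 𝓑.carrier, TangentSpace (𝓡 4) y) y) :
          TangentBundle (𝓡 4) 𝓑.carrier)) x :=
      mdifferentiableAt_zeroSection ..
    have hev : ∀ᶠ y in 𝓝 x, D y = (0 : Π y : 𝓑.carrier, TangentSpace (𝓡 4) y) y :=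
      Filter.eventually_of_mem ((hU'.inter hdoc).mem_nhds ⟨hxU', hxd⟩) fun y hy ↦ by
        rw [Pi.zero_apply]
        exact hD0 y hy
    rw [(𝓑.metric.leviCivita.isCovariantDerivativeOn (s := univ)).congr_of_eventuallyEq hDx h0x
      Filter.univ_mem hev, 𝓑.metric.leviCivita.zero, Pi.zero_apply, zero_apply]
  have hcovD : 𝓑.metric.leviCivita D p (𝓑.killing p) = 0 :=
    stub_horizonKilling_eq_zero_of_mem_closure
      (σ := fun y ↦ 𝓑.metric.leviCivita D y (𝓑.killing y))
      hS.continuousAt.continuousWithinAt (hclos p hp) hS0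
  -- (iii) pointwise algebra at `p`
  have hDp' : MDifferentiableAt (𝓡 4) (𝓡 4).tangent
      (fun y ↦ (TotalSpace.mk' E4 y (D y) : TangentBundle (𝓡 4) 𝓑.carrier)) p :=
    (hDc p hpU).mdifferentiableAt (by simp)
  have hTp' : MDifferentiableAt (𝓡 4) (𝓡 4).tangent
      (fun y ↦ (TotalSpace.mk' E4 y (𝓑.killing y) : TangentBundle (𝓡 4) 𝓑.carrier)) p :=
    (hTc p).mdifferentiableAt (by simp)
  have hcTp' : MDifferentiableAt (𝓡 4) (𝓡 4).tangent
      (fun y ↦ (TotalSpace.mk' E4 y ((c • 𝓑.killing) y) : TangentBundle (𝓡 4) 𝓑.carrier)) p :=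
    hTp'.smul_const_section
  have hKD : K = D + c • 𝓑.killing := by rw [hD, sub_add_cancel]
  have hcovK : 𝓑.metric.leviCivita K p =
      𝓑.metric.leviCivita D p + c • 𝓑.metric.leviCivita 𝓑.killing p := by
    rw [hKD, (𝓑.metric.leviCivita.isCovariantDerivativeOn (s := univ)).add hDp' hcTp',
      (𝓑.metric.leviCivita.isCovariantDerivativeOn (s := univ)).smul_const c hTp']
  have hκ := hκK p hp
  rw [hcovK, hKp p hp] at hκ
  rw [add_apply, smul_apply, map_smul, map_smul, hcovD, smul_zero, zero_add] at hκ
  -- `hκ : c • c • ∇_T T = κ • c • T p`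
  have h1 : c • (c • 𝓑.metric.leviCivita 𝓑.killing p (𝓑.killing p)) = c • (κ • 𝓑.killing p) := by
    rw [hκ, smul_comm κ c]
  have h2 : c • 𝓑.metric.leviCivita 𝓑.killing p (𝓑.killing p) = κ • 𝓑.killing p :=
    smul_right_injective _ hc0 h1
  calc 𝓑.metric.leviCivita 𝓑.killing p (𝓑.killing p)
      = c⁻¹ • (c • 𝓑.metric.leviCivita 𝓑.killing p (𝓑.killing p)) := (inv_smul_smul₀ hc0 _).symm
    _ = c⁻¹ • (κ • 𝓑.killing p) := by rw [h2]
    _ = (c⁻¹ * κ) • 𝓑.killing p := smul_smul _ _ _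

end Summit.FinalStateConjecture.FinalStateConjecture.Theorems.HawkingExtensionIsKerr.SketchIdeator2

end
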